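import Summits.Ventures.PercRepro.RankLevelSetHallLostFrac

/-!
# PercRepro — RULE BIN: A BIG `Y`-SET SPLITS ITS UNIT AMONG ITS LOST SUBSETS PROPORTIONALLY TO THEIR LYM MASS `C(#S, q)`
— THE LOST-SET RULE OF RECORD FOR THE UP-HALL FORM AT THE TIGHT LAYER (p4, gen 33; C-044, UP form; paper
proofs/P4-CELL-THREE.md §14.20 (g))

Among the lost-set-level splittings tested (the equal split, the Boolean LYM weight `1/C(#T, #S)`, `2^{#S}`, the largest
subsets only, the full traces first), the weight `C(#S, q)` — the number of `q`-subsets of the lost set `S`, its LYM mass —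
is the one that survives everywhere: receipts `≥ 4/3` on every matroid with `≤ 8` elements, `≥ 20/13` on every matroid with
`9` elements, EXACTLY `2` for the big flat of the model `T_p(U_{q,2q} ⊕ U_{q+1,q+1})` at every `q` (the equal split and the
Boolean weight fall below `1` there from `q = 9` and `q = 10`), `≥ 1.68` on the nested families of §14.19 and `≥ 1.51` on
2,240 adversarial instances with `n ≤ 14`.  THIS FILE: the weight `lostBinWeight S T = C(#S, q) / B(T)` on the pairs of a
lost `S ⊆ T ∈ bigY`, `B(T) = Σ_{S' lost ⊆ T} C(#S', q)` (`lostMass`); every big `Y`-set is loaded EXACTLY `1` (or `0` when it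
contains no lost set); `LostBin M p q` — every lost set receives at least `1` — is a `Prop`, NOT asserted; it gives a
fractional lost-set matching (`lostFrac_of_lostBin`), hence the UP-Hall form (`hallUp_of_ncard_eq_of_lostBin`).
At the member level the rule reads: a big `T` gives each member `Z ⊆ T` the number of lost sets `S` with `Z ⊆ S ⊆ T`,
divided by `B(T)` — one unit of `T` spread uniformly over the pairs (lost subset, `q`-subset of it).
* `lostMass`, `lostBinWeight`, `lostBinRecv`, `LostBin`;
* `lostBinWeight_load_le_one` — loads `≤ 1` for every big `Y`-set (exactly `B(T)/B(T)`);
* `lostFrac_of_lostBin`, **`hallUp_of_ncard_eq_of_lostBin`**.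
Axioms: standard.
-/

namespace PercRepro

open Set Matroid Finset

variable {α : Type} (M : Matroid α) [M.Finite]

/-- The **LYM mass of the lost subsets** of `T`: `B(T) = Σ_{S lost, S ⊆ T} C(#S, q)`. -/
noncomputable def lostMass (p q : ℕ) (T : Set α) : ℚ := by
  classical
  exact ∑ S ∈ (lostSets_finite M p q).toFinset, (if S ⊆ T then ((S.ncard.choose q : ℕ) : ℚ) else 0)

/-- **Rule BIN's weight** of the pair `(S, T)`: for a lost set `S` inside the big `Y`-set `T`, `C(#S, q) / B(T)`;
`0` otherwise. -/
noncomputable def lostBinWeight (p q : ℕ) (S T : Set α) : ℚ := by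
  classical
  exact if S ∈ lostSets M p q ∧ T ∈ bigY M p q ∧ S ⊆ T then ((S.ncard.choose q : ℕ) : ℚ) / lostMass M p q T else 0

/-- What the lost set `S` receives under Rule BIN. -/
noncomputable def lostBinRecv (p q : ℕ) (S : Set α) : ℚ :=
  ∑ T ∈ (bigY_finite M p q).toFinset, lostBinWeight M p q S T

/-- **(R-BIN)** — a `Prop`, NOT asserted: every lost set receives at least `1` under Rule BIN. -/
def LostBin (p q : ℕ) : Prop := ∀ S ∈ lostSets M p q, 1 ≤ lostBinRecv M p q S

/-- The LYM mass is non-negative. -/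
theorem lostMass_nonneg (p q : ℕ) (T : Set α) : 0 ≤ lostMass M p q T := by
  classical
  unfold lostMass
  refine Finset.sum_nonneg (fun S _ => ?_)
  split_ifs <;> positivity

/-- Rule BIN's weights are non-negative. -/
theorem lostBinWeight_nonneg (p q : ℕ) (S T : Set α) : 0 ≤ lostBinWeight M p q S T := by
  classical
  unfold lostBinWeight
  split_ifs
  · exact div_nonneg (by positivity) (lostMass_nonneg M p q T)
  · exact le_rfl

/-- Rule BIN's weights are supported on the pairs of a lost set inside a big `Y`-set. -/
theorem lostBinWeight_support (p q : ℕ) (S T : Set α) (h : lostBinWeight M p q S T ≠ 0) :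
    S ∈ lostSets M p q ∧ T ∈ bigY M p q ∧ S ⊆ T := by
  classical
  unfold lostBinWeight at h
  by_contra hc
  exact h (if_neg hc)

/-- **Every big `Y`-set is loaded at most `1`** under Rule BIN: the load is `B(T) / B(T)`. -/
theorem lostBinWeight_load_le_one (p q : ℕ) (T : Set α) (hT : T ∈ bigY M p q) :
    ∑ S ∈ (lostSets_finite M p q).toFinset, lostBinWeight M p q S T ≤ 1 := by
  classical
  have hw : ∀ S ∈ (lostSets_finite M p q).toFinset, lostBinWeight M p q S T
      = (if S ⊆ T then ((S.ncard.choose q : ℕ) : ℚ) else 0) / lostMass M p q T := by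
    intro S hS
    rw [(lostSets_finite M p q).mem_toFinset] at hS
    unfold lostBinWeight
    by_cases hST : S ⊆ T
    · rw [if_pos ⟨hS, hT, hST⟩, if_pos hST]
    · rw [if_neg (fun hc => hST hc.2.2), if_neg hST, zero_div]
  rw [Finset.sum_congr rfl hw, ← Finset.sum_div]
  exact div_self_le_one _

/-- **Rule BIN is a fractional lost-set matching** whenever every lost set receives at least `1`. -/
theorem lostFrac_of_lostBin (p q : ℕ) (h : LostBin M p q) : LostFrac M p q :=
  ⟨lostBinWeight M p q, lostBinWeight_nonneg M p q, lostBinWeight_support M p q, fun S hS => h S hS,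
    fun T hT => lostBinWeight_load_le_one M p q T hT⟩

/-- **THE TRANSFER FOR RULE BIN**: at the tight layer `#E = p + q` with `q < p`, if every lost set receives at least `1`
under Rule BIN, then every family of members has at least `Φ(p,q)·#𝒜` UP-neighbours. -/
theorem hallUp_of_ncard_eq_of_lostBin (p q : ℕ) (hE : M.E.ncard = p + q) (hpq : q < p) (h : LostBin M p q)
    (𝒜 : Set (Set α)) (h𝒜 : 𝒜 ⊆ cellMembers M p q) :
    phiK p q * (𝒜.ncard : ℚ) ≤ ((upNbhd M p q 𝒜).ncard : ℚ) :=
  hallUp_of_ncard_eq_of_lostFrac M p q hE hpq (lostFrac_of_lostBin M p q h) 𝒜 h𝒜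

end PercRepro
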